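import Mathlib.Analysis.SpecialFunctions.Sqrt
import Mathlib.Analysis.InnerProductSpace.Calculus
import Mathlib.Algebra.Order.Chebyshev
import HarnessLib

/-!
# The regularised modulus `√(ε² + ∑ⱼ |fⱼ|²) − ε`: convexity inequality for gradients

Topic `Literature/MathematicalPhysics/QuantumManyBody` (pointwise tools for `BosonicFloor.lean`:
"the bosonic ground-state energy of `H = -∑ᵢ Δᵢ + ∑_{i<j} v` is its absolute ground-state energy"
[LSSY2005, Ch. 2], proved by symmetrisation of `|Ψ|²` over the permutations and the convexity of
`ρ ↦ ∫ |∇√ρ|²`, without Perron–Frobenius theory).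

For finitely many functions `f j : E → ℂ` (`j ∈ ι`, a `Fintype`) on a real normed space `E` and a
regularisation parameter `ε > 0` put `F = ∑ⱼ ‖f j‖²` and `g_ε = √(ε² + F) − ε`. This file proves
the pointwise facts

* `sqrtReg_nonneg`, `sqrtReg_sq_le`, `sqrtReg_eq_zero` : `0 ≤ g_ε`, `g_ε² ≤ F`, `g_ε = 0 → F = 0`;
* `tendsto_sqrtReg`, `tendsto_sqrtReg_sq` : `g_{1/(n+1)} → √F` and `g_{1/(n+1)}² → F`;
* `hasFDerivAt_sum_norm_sq`, `hasFDerivAt_sqrtReg`, `contDiff_sqrtReg` : `D F = 2 ∑ⱼ ⟨fⱼ, D fⱼ⟩_ℝ`,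
  `D g_ε = D F / (2√(ε² + F))`, and `g_ε` is `Cⁿ` when the `fⱼ` are;
* `norm_fderiv_sqrtReg_sq_le` : the **convexity (diamagnetic) inequality for gradients**
  `‖D g_ε(x) u‖² ≤ ∑ⱼ ‖D fⱼ(x) u‖²` [Lieb–Loss, *Analysis*, Thm. 7.8 (with 6.17)]: by Cauchy–Schwarz
  `|D F u|² ≤ 4 F ∑ⱼ ‖D fⱼ u‖²`, whence `‖D g_ε u‖² = |D F u|² / (4(ε² + F)) ≤ ∑ⱼ ‖D fⱼ u‖²`;
* `nnnorm_fderiv_ofReal_sqrtReg_sq_le`, `nnnorm_ofReal_sqrtReg_sq_le`,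
  `nnnorm_ofReal_sqrtReg_sq_eq` : the same bounds for the complexified `(g_ε : ℂ)` in the `ℝ≥0∞`
  form in which kinetic densities `∑ ‖∂Ψ‖₊²` are written.

The regularisation `ε > 0` keeps `g_ε` of class `C¹` (the modulus `√F` itself is only Lipschitz
where `F` vanishes), and subtracting `ε` keeps `g_ε² ≤ F`, so that multiplying by a non-negative,
possibly infinite, potential does not increase the potential energy. Nothing here is specific to
the Bose gas; Mathlib has the ingredients (`HasFDerivAt.norm_sq`, `HasFDerivAt.sqrt`,
`Finset.sum_mul_sq_le_sq_mul_sq`) but not the assembled inequality (searched `sqrt`, `norm_sq`,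
`diamagnetic`, `convexity` + `gradient`).

## References

* [LiebLoss2001] E. H. Lieb, M. Loss, *Analysis*, 2nd ed., AMS 2001: Thm. 6.17 (derivative of the
  absolute value), Thm. 7.8 (convexity inequality for gradients).
* [LSSY2005] E. H. Lieb, R. Seiringer, J. P. Solovej, J. Yngvason, *The Mathematics of the Bose Gas
  and its Condensation*, Birkhäuser 2005, Ch. 2 (bosonic = absolute ground-state energy).
-/

noncomputable section

open Filter Topology
open scoped InnerProductSpace ENNReal NNReal

namespace Literature.MathematicalPhysics.QuantumManyBody.BoseGas

/-! ### Elementary inequalities for `√(ε² + F) − ε` -/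

/-- `0 ≤ √(ε² + F) − ε` for `ε, F ≥ 0`. [folklore] -/
theorem sqrtReg_nonneg {ε F : ℝ} (hε : 0 ≤ ε) (hF : 0 ≤ F) : 0 ≤ Real.sqrt (ε ^ 2 + F) - ε := by
  rw [sub_nonneg, Real.le_sqrt hε (by positivity)]
  linarith

/-- `(√(ε² + F) − ε)² ≤ F` for `ε, F ≥ 0` (equivalently `√(ε² + F) ≤ √F + ε`). [folklore] -/
theorem sqrtReg_sq_le {ε F : ℝ} (hε : 0 ≤ ε) (hF : 0 ≤ F) :
    (Real.sqrt (ε ^ 2 + F) - ε) ^ 2 ≤ F := by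
  have h1 : Real.sqrt (ε ^ 2 + F) - ε ≤ Real.sqrt F := by
    rw [sub_le_iff_le_add, Real.sqrt_le_iff]
    refine ⟨by positivity, ?_⟩
    nlinarith [Real.sq_sqrt hF, Real.sqrt_nonneg F]
  calc (Real.sqrt (ε ^ 2 + F) - ε) ^ 2 ≤ Real.sqrt F ^ 2 :=
        pow_le_pow_left₀ (sqrtReg_nonneg hε hF) h1 2
    _ = F := Real.sq_sqrt hF

/-- `√(ε² + F) − ε = 0` forces `F = 0` (for `F ≥ 0`). [folklore] -/
theorem sqrtReg_eq_zero {ε F : ℝ} (hF : 0 ≤ F) (h : Real.sqrt (ε ^ 2 + F) - ε = 0) :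
    F = 0 := by
  rw [sub_eq_zero] at h
  have h2 : Real.sqrt (ε ^ 2 + F) ^ 2 = ε ^ 2 := by rw [h]
  rw [Real.sq_sqrt (by positivity)] at h2
  linarith

/-- `√(εₙ² + F) − εₙ → √F` along `εₙ = 1/(n+1) → 0⁺` (continuity of `ε ↦ √(ε² + F) − ε` at `0`).
[folklore] -/
theorem tendsto_sqrtReg (F : ℝ) :
    Tendsto (fun n : ℕ => Real.sqrt ((1 / ((n : ℝ) + 1)) ^ 2 + F) - 1 / ((n : ℝ) + 1)) atTop
      (𝓝 (Real.sqrt F)) := by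
  have hc : Continuous fun ε : ℝ => Real.sqrt (ε ^ 2 + F) - ε := by fun_prop
  have h := hc.tendsto 0
  simp only [ne_eq, OfNat.ofNat_ne_zero, not_false_eq_true, zero_pow, zero_add, sub_zero] at h
  exact h.comp tendsto_one_div_add_atTop_nhds_zero_nat

/-- `(√(εₙ² + F) − εₙ)² → F` along `εₙ = 1/(n+1)`, for `F ≥ 0`. [folklore] -/
theorem tendsto_sqrtReg_sq {F : ℝ} (hF : 0 ≤ F) :
    Tendsto (fun n : ℕ => (Real.sqrt ((1 / ((n : ℝ) + 1)) ^ 2 + F) - 1 / ((n : ℝ) + 1)) ^ 2) atTop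
      (𝓝 F) := by
  have h := (tendsto_sqrtReg F).pow 2
  rwa [Real.sq_sqrt hF] at h

/-- `(‖a‖₊)² = ofReal (‖a‖²)` in `ℝ≥0∞`. [folklore] -/
theorem coe_nnnorm_pow_two_eq_ofReal {G : Type*} [SeminormedAddCommGroup G] (a : G) :
    ((‖a‖₊ : ℝ≥0∞)) ^ 2 = ENNReal.ofReal (‖a‖ ^ 2) := by
  rw [ENNReal.ofReal_pow (norm_nonneg _), ofReal_norm, enorm_eq_nnnorm]

/-! ### Differentiability and the convexity inequality for gradients -/

variable {E : Type*} {ι : Type*} [Fintype ι] (f : ι → E → ℂ)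

/-- `‖(g_ε(x) : ℂ)‖₊² = ofReal (g_ε(x)²)`. [folklore] -/
theorem nnnorm_ofReal_sqrtReg_sq_eq (x : E) (ε : ℝ) :
    ((‖((Real.sqrt (ε ^ 2 + ∑ j, ‖f j x‖ ^ 2) - ε : ℝ) : ℂ)‖₊ : ℝ≥0∞)) ^ 2 =
      ENNReal.ofReal ((Real.sqrt (ε ^ 2 + ∑ j, ‖f j x‖ ^ 2) - ε) ^ 2) := by
  rw [Complex.nnnorm_real, coe_nnnorm_pow_two_eq_ofReal, Real.norm_eq_abs, sq_abs]

/-- `‖(g_ε(x) : ℂ)‖₊² ≤ ∑ⱼ ‖fⱼ(x)‖₊²` (from `g_ε² ≤ F`). [folklore] -/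
theorem nnnorm_ofReal_sqrtReg_sq_le (x : E) {ε : ℝ} (hε : 0 < ε) :
    ((‖((Real.sqrt (ε ^ 2 + ∑ j, ‖f j x‖ ^ 2) - ε : ℝ) : ℂ)‖₊ : ℝ≥0∞)) ^ 2 ≤
      ∑ j, ((‖f j x‖₊ : ℝ≥0∞)) ^ 2 := by
  rw [nnnorm_ofReal_sqrtReg_sq_eq]
  calc ENNReal.ofReal ((Real.sqrt (ε ^ 2 + ∑ j, ‖f j x‖ ^ 2) - ε) ^ 2)
      ≤ ENNReal.ofReal (∑ j, ‖f j x‖ ^ 2) :=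
        ENNReal.ofReal_le_ofReal (sqrtReg_sq_le hε.le (by positivity))
    _ = ∑ j, ENNReal.ofReal (‖f j x‖ ^ 2) := ENNReal.ofReal_sum_of_nonneg fun _ _ => sq_nonneg _
    _ = ∑ j, ((‖f j x‖₊ : ℝ≥0∞)) ^ 2 :=
        Finset.sum_congr rfl fun _ _ => (coe_nnnorm_pow_two_eq_ofReal _).symm

/-- `ofReal (∑ⱼ ‖fⱼ(x)‖²) = ∑ⱼ ‖fⱼ(x)‖₊²`: the symmetrised square modulus in `ℝ≥0∞`. [folklore] -/
theorem ofReal_sum_norm_sq (x : E) :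
    ENNReal.ofReal (∑ j, ‖f j x‖ ^ 2) = ∑ j, ((‖f j x‖₊ : ℝ≥0∞)) ^ 2 :=
  (ENNReal.ofReal_sum_of_nonneg fun _ _ => sq_nonneg _).trans
    (Finset.sum_congr rfl fun _ _ => (coe_nnnorm_pow_two_eq_ofReal _).symm)

variable [NormedAddCommGroup E] [NormedSpace ℝ E]

/-- `F = ∑ⱼ ‖fⱼ‖²` has derivative `D F(x) = ∑ⱼ 2 ⟨fⱼ(x), D fⱼ(x) ·⟩_ℝ` (`ℂ` as a real inner product
space). [folklore] -/
theorem hasFDerivAt_sum_norm_sq {x : E} (hf : ∀ j, DifferentiableAt ℝ (f j) x) :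
    HasFDerivAt (fun y => ∑ j, ‖f j y‖ ^ 2)
      (∑ j, (2 : ℕ) • (innerSL ℝ (f j x)).comp (fderiv ℝ (f j) x)) x :=
  HasFDerivAt.fun_sum fun j _ => (hf j).hasFDerivAt.norm_sq

/-- `g_ε = √(ε² + F) − ε` has derivative `D g_ε(x) = D F(x) / (2√(ε² + F(x)))` (`ε > 0`, so that
`ε² + F > 0`). [folklore] -/
theorem hasFDerivAt_sqrtReg {x : E} (hf : ∀ j, DifferentiableAt ℝ (f j) x) {ε : ℝ} (hε : 0 < ε) :
    HasFDerivAt (fun y => Real.sqrt (ε ^ 2 + ∑ j, ‖f j y‖ ^ 2) - ε)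
      ((1 / (2 * Real.sqrt (ε ^ 2 + ∑ j, ‖f j x‖ ^ 2))) •
        ∑ j, (2 : ℕ) • (innerSL ℝ (f j x)).comp (fderiv ℝ (f j) x)) x := by
  have hpos : ε ^ 2 + ∑ j, ‖f j x‖ ^ 2 ≠ 0 := ne_of_gt (by positivity)
  exact (((hasFDerivAt_sum_norm_sq f hf).const_add (ε ^ 2)).sqrt hpos).sub_const ε

/-- `g_ε` is `Cⁿ` when all `fⱼ` are (`ε > 0`). [folklore] -/
theorem contDiff_sqrtReg {n : WithTop ℕ∞} (hf : ∀ j, ContDiff ℝ n (f j)) {ε : ℝ} (hε : 0 < ε) :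
    ContDiff ℝ n (fun y => Real.sqrt (ε ^ 2 + ∑ j, ‖f j y‖ ^ 2) - ε) := by
  have h1 : ContDiff ℝ n fun y => ε ^ 2 + ∑ j, ‖f j y‖ ^ 2 :=
    contDiff_const.add (ContDiff.sum fun j _ => (hf j).norm_sq ℝ)
  exact (h1.sqrt fun y => ne_of_gt (by positivity)).sub contDiff_const

/-- **Convexity inequality for gradients** (pointwise, regularised form): for `ε > 0` and every
direction `u`, `‖D(√(ε² + ∑ⱼ ‖fⱼ‖²) − ε)(x) u‖² ≤ ∑ⱼ ‖D fⱼ(x) u‖²`. With `F = ∑ⱼ ‖fⱼ‖²`: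
`D F u = 2∑ⱼ ⟨fⱼ, D fⱼ u⟩_ℝ`, so `|D F u|² ≤ 4 F ∑ⱼ ‖D fⱼ u‖²` by Cauchy–Schwarz (in `ℂ ≅ ℝ²` and in
`ℓ²(ι)`), and `|D g_ε u|² = |D F u|² / (4(ε² + F)) ≤ ∑ⱼ ‖D fⱼ u‖²`. This is the pointwise content of
the convexity of `(f₁, …, f_m) ↦ |∇ √(∑|fⱼ|²)|²`. [cite: LiebLoss2001, Thm. 7.8] -/
theorem norm_fderiv_sqrtReg_sq_le {x : E} (hf : ∀ j, DifferentiableAt ℝ (f j) x) {ε : ℝ}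
    (hε : 0 < ε) (u : E) :
    ‖fderiv ℝ (fun y => Real.sqrt (ε ^ 2 + ∑ j, ‖f j y‖ ^ 2) - ε) x u‖ ^ 2 ≤
      ∑ j, ‖fderiv ℝ (f j) x u‖ ^ 2 := by
  rw [(hasFDerivAt_sqrtReg f hf hε).fderiv]
  set A : ℝ := ∑ j, ‖f j x‖ ^ 2 with hA
  set S : ℝ := ∑ j, ‖fderiv ℝ (f j) x u‖ ^ 2 with hS
  have hA0 : 0 ≤ A := by positivity
  have hS0 : 0 ≤ S := by positivity
  have hr2 : Real.sqrt (ε ^ 2 + A) ^ 2 = ε ^ 2 + A := Real.sq_sqrt (by positivity)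
  -- the derivative applied to `u`
  have happ : ((1 / (2 * Real.sqrt (ε ^ 2 + A))) •
      ∑ j, (2 : ℕ) • (innerSL ℝ (f j x)).comp (fderiv ℝ (f j) x)) u =
      (1 / (2 * Real.sqrt (ε ^ 2 + A))) * ∑ j, 2 * ⟪f j x, fderiv ℝ (f j) x u⟫_ℝ := by
    simp only [smul_apply, sum_apply, ContinuousLinearMap.comp_apply, innerSL_apply_apply,
      smul_eq_mul, nsmul_eq_mul, Nat.cast_ofNat]
  rw [happ]
  set d : ℝ := ∑ j, 2 * ⟪f j x, fderiv ℝ (f j) x u⟫_ℝ with hd_def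
  -- Cauchy–Schwarz, twice
  have hd : |d| ≤ 2 * ∑ j, ‖f j x‖ * ‖fderiv ℝ (f j) x u‖ := by
    calc |d| ≤ ∑ j, |2 * ⟪f j x, fderiv ℝ (f j) x u⟫_ℝ| := Finset.abs_sum_le_sum_abs _ _
      _ ≤ ∑ j, 2 * (‖f j x‖ * ‖fderiv ℝ (f j) x u‖) := Finset.sum_le_sum fun j _ => by
          rw [abs_mul, abs_two]
          exact mul_le_mul_of_nonneg_left (abs_real_inner_le_norm _ _) zero_le_two
      _ = 2 * ∑ j, ‖f j x‖ * ‖fderiv ℝ (f j) x u‖ := by rw [Finset.mul_sum]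
  have hCS : (∑ j, ‖f j x‖ * ‖fderiv ℝ (f j) x u‖) ^ 2 ≤ A * S :=
    Finset.sum_mul_sq_le_sq_mul_sq _ _ _
  have hd2 : d ^ 2 ≤ 4 * (A * S) := by
    have h1 : d ^ 2 ≤ (2 * ∑ j, ‖f j x‖ * ‖fderiv ℝ (f j) x u‖) ^ 2 := by
      rw [← sq_abs d]
      exact pow_le_pow_left₀ (abs_nonneg _) hd 2
    nlinarith [h1, hCS]
  rw [Real.norm_eq_abs, sq_abs, mul_pow, div_pow, one_pow, mul_pow, hr2, div_mul_eq_mul_div,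
    one_mul, div_le_iff₀ (by positivity)]
  nlinarith [hd2, mul_nonneg hS0 (sq_nonneg ε)]

/-- The convexity inequality for the complexified `(g_ε : ℂ)`, in `ℝ≥0∞`:
`‖D(↑g_ε)(x) u‖₊² ≤ ∑ⱼ ‖D fⱼ(x) u‖₊²`. [cite: LiebLoss2001, Thm. 7.8] -/
theorem nnnorm_fderiv_ofReal_sqrtReg_sq_le {x : E} (hf : ∀ j, DifferentiableAt ℝ (f j) x) {ε : ℝ}
    (hε : 0 < ε) (u : E) :
    ((‖fderiv ℝ (fun y => ((Real.sqrt (ε ^ 2 + ∑ j, ‖f j y‖ ^ 2) - ε : ℝ) : ℂ)) x u‖₊ : ℝ≥0∞)) ^ 2 ≤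
      ∑ j, ((‖fderiv ℝ (f j) x u‖₊ : ℝ≥0∞)) ^ 2 := by
  have hg := hasFDerivAt_sqrtReg f hf hε
  have hcomp : (fun y => ((Real.sqrt (ε ^ 2 + ∑ j, ‖f j y‖ ^ 2) - ε : ℝ) : ℂ)) =
      Complex.ofRealCLM ∘ fun y => Real.sqrt (ε ^ 2 + ∑ j, ‖f j y‖ ^ 2) - ε := rfl
  rw [hcomp, (Complex.ofRealCLM.hasFDerivAt.comp x hg).fderiv, ContinuousLinearMap.comp_apply,
    Complex.ofRealCLM_apply, Complex.nnnorm_real, ← hg.fderiv, coe_nnnorm_pow_two_eq_ofReal]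
  calc ENNReal.ofReal (‖fderiv ℝ (fun y => Real.sqrt (ε ^ 2 + ∑ j, ‖f j y‖ ^ 2) - ε) x u‖ ^ 2)
      ≤ ENNReal.ofReal (∑ j, ‖fderiv ℝ (f j) x u‖ ^ 2) :=
        ENNReal.ofReal_le_ofReal (norm_fderiv_sqrtReg_sq_le f hf hε u)
    _ = ∑ j, ENNReal.ofReal (‖fderiv ℝ (f j) x u‖ ^ 2) :=
        ENNReal.ofReal_sum_of_nonneg fun j _ => sq_nonneg _
    _ = ∑ j, ((‖fderiv ℝ (f j) x u‖₊ : ℝ≥0∞)) ^ 2 :=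
        Finset.sum_congr rfl fun j _ => (coe_nnnorm_pow_two_eq_ofReal _).symm

end Literature.MathematicalPhysics.QuantumManyBody.BoseGas

end
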